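import Summits.ResolutionOfSingularities.ResolutionOfSingularities.Theorems.HomologicalConductorNoZenoTraceSocleResidual
import HarnessLib

/-!
# Crux `NoZenoR` / `NoZeno` (stmt-ResolutionOfSingularities-19943 / -16483), β1 layer:
# TRACE-SOCLE — THEOREM A «CURVE-CONFINED THREADLESS TOWERS TERMINATE» and its corollaries A₁, A₂
# (port of res-L0-w44-idea-1's Sketch r12 §r12.6)

`[OURS · L W4.4]` Tree port (seat res-L0-w44-stub-1 g8, CHAIN v20 (ρ34e)) of
`L/res-L0-w44-idea-1/Sketch-idea-1-r12.lean` (sha16 `4a9f7a6f66dee56f`; tri-2 TRIAGE v13.2 R21: THM A / A₁ / A₂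
PASS as PROVED, axioms standard; tri-1 §41.2), AUTHOR res-L0-w44-idea-1 (card 10 `trace-socle`); statements and
proofs are the ideator's, with the trace field spelled out
(`IntermediateField.adjoin k (Set.range fun x : T_m₁ => residue W ⟨x, _⟩)`).  Bears on β1ʳ¹♯
`Coarsening.Sig.stub_beta1RankOneSharp` / β1ᶜᶻ♯ `stub_noCaZenoChainSharp` of the v28 registry (tri-2: A₂ is the
non-vacuous registry gain — the slice «∃ W > O with tr.deg_k κ(W) ≤ 1» terminates outright).  Nothing here is a
statement of the manuscript under review (Hironaka 2017); AI-written, weaker than expert review; support-level,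
counted 0.  The registry-level texts of Sketch §r12.7 (`Beta1RankOneSharp`, `ShannonTransferSharp`,
`Beta1SharpExhaustive`, `Beta1SharpConfinedHard`, the split) are NOT ported here (lead / strategist wording).

* `terminates_of_traceChains` — the core: threadless tower (radical persistence, `StrictDrop`), escape witness
  into `W` at stage `m₁`, all stages in `W`, a valuation ring `Ū` of `κ(W)` containing the stage residues and
  dominating the residual union, a set `F ⊆ κ(W)` containing every stage residue, chain condition for `Ū` on
  chains in `F` ⇒ a regular stage.
* `terminates_of_noetherianResidualDominator` (`F = κ(W)`, `Ū` Noetherian), `terminates_of_noetherianTrace`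
  (confinement from stage `m₁` + Noetherian TRACE of `Ū` on the trace field `k(res_W T_m₁)`).
* **`curveConfined_terminates`** (THEOREM A) — confinement by `W ∋ k` from stage `m₁` with an escape witness and
  trace field of transcendence degree `≤ 1` ⇒ a regular stage; every transcendence degree, every rank of `O`,
  defect `W` allowed; `curveConfined_terminates'` (the `k ⊆ W` form via `algebraOfMem`).
* `curveResidueField_terminates` (A₁: `tr.deg_k κ(W) ≤ 1`), **`curveCoarsening_terminates`** (A₂: a COARSENING
  `W ≥ O` of residual transcendence degree `≤ 1` into which the tower escapes ⇒ termination; confinement by CT +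
  persistence + the tree's `Coarsening.tower_le_loc_of_unit`).

References: O. Zariski, P. Samuel, *Commutative Algebra* II (1960), VI §14 Thm. 31 [`ZariskiSamuel1960`] (via
the tree); Fernández–Shannon-type switching, arXiv:1505.06445 (context of the residual `ShannonTransferSharp`,
not used).
-/

noncomputable section

-- single-problem summit: the doubled namespace component `ResolutionOfSingularities` is forced
set_option linter.dupNamespace false

namespace Summit.ResolutionOfSingularities.ResolutionOfSingularities.Theorems.NoZeno.TraceSocle

open Summit.ResolutionOfSingularities.ResolutionOfSingularities.Theses.HomologicalConductor
open Summit.ResolutionOfSingularities.ResolutionOfSingularities.Theorems.NoZeno.Birth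
open Summit.ResolutionOfSingularities.ResolutionOfSingularities.Theorems.NoZeno.SandwichCluster.Parasite
open Summit.ResolutionOfSingularities.ResolutionOfSingularities.Theorems
open Summit.ResolutionOfSingularities.ResolutionOfSingularities.Theorems.NoZeno
open Literature.AlgebraicGeometry.Resolution
open IsLocalRing

variable {k K : Type} [Field k] [Field K] [Algebra k K]

/-! ## §r12.6 THEOREM A (PROVED): curve-confined threadless towers terminate; and the general
«noetherian trace» terminator it instantiates -/

/-- **TERMINATION FROM TRACE CHAINS (PROVED; the core).**  A threadless tower (radical persistence, StrictDrop)
with an escape witness into `W` at stage `m₁`, all stages inside `W`, a valuation ring `Ū` of `κ(W)` containing the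
stage residues and DOMINATING the residual union, a subset `F ⊆ κ(W)` containing every stage residue, and the
descending chain condition for `Ū` on chains in `F`, has a regular stage.  Any transcendence degree, any rank of
`O`, `W` not comparable with `O`; no `hzd`. [this work] -/
theorem terminates_of_traceChains (hP : PersistenceRadical) (hD : StrictDrop) (p : ℕ) (hp : p.Prime)
    (k K : Type) [Field k] [CharP k p] [Field K] [Algebra k K] (O : ValuationSubring K)
    (A : Subalgebra k K) (hk : ∀ c : k, algebraMap k K c ∈ O) (hA : A.FG)
    (hfr : IsFractionRing ↥A K) (hAO : A.toSubring ≤ O.toSubring)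
    (hthr : ¬ SingularPrimeThread O A)
    (W : ValuationSubring K) (m₁ : ℕ)
    (hesc : ∃ s ∈ tower O A m₁, s⁻¹ ∈ W ∧ s⁻¹ ∉ O)
    (hW : ∀ m : ℕ, ∀ s ∈ tower O A m, s ∈ W)
    (Ū : ValuationSubring (ResidueField W))
    (hres : ∀ (m : ℕ) (s : K) (hs : s ∈ tower O A m), residue W ⟨s, hW m s hs⟩ ∈ Ū)
    (hdomr : ∀ (m : ℕ) (s : K) (hs : s ∈ tower O A m), s⁻¹ ∈ W →
      (residue W ⟨s, hW m s hs⟩)⁻¹ ∈ Ū → s⁻¹ ∈ O)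
    (F : Set (ResidueField W))
    (hzF : ∀ (m : ℕ) (z : K), z ∈ tower O A m → ∃ h : z ∈ W, residue W ⟨z, h⟩ ∈ F)
    (hdisc : ∀ r : ℕ → ResidueField W, (∀ n, r n ∈ F) → (∀ n, r n ∈ Ū ∧ r n ≠ 0) →
      (∀ n, r n * (r (n + 1))⁻¹ ∈ Ū) → ∃ n, r (n + 1) * (r n)⁻¹ ∈ Ū) :
    ∃ m : ℕ, IsRegularLocalRing ↥(tower O A m) := by
  classical
  set U := residueOverringLift W Ū with hUdef
  have hUW : U ≤ W := residueOverringLift_le W Ū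
  have hdomU := dominates_residueLift O A W Ū hW hres hdomr
  have hacc : ∀ z : ℕ → K, (∀ n : ℕ, (∃ m : ℕ, z n ∈ tower O A m) ∧ z n ≠ 0 ∧ (z n)⁻¹ ∈ W) →
      (∀ n : ℕ, z n * (z (n + 1))⁻¹ ∈ U) → ∃ n : ℕ, z (n + 1) * (z n)⁻¹ ∈ U := by
    intro z hz hch
    have hz' : ∀ n : ℕ, z n ∈ residueOverringLift W Ū ∧ z n ≠ 0 ∧ (z n)⁻¹ ∈ W := fun n => by
      obtain ⟨⟨m, hzm⟩, hz0, hzW⟩ := hz n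
      exact ⟨(hdomU m _ hzm).1, hz0, hzW⟩
    have hzF' : ∀ n : ℕ, ∃ h : z n ∈ W, residue W ⟨z n, h⟩ ∈ F := fun n => by
      obtain ⟨⟨m, hzm⟩, -, -⟩ := hz n
      exact hzF m (z n) hzm
    exact hacc_of_traceChains W Ū F hdisc z hz' hzF' hch
  obtain ⟨s, hs, hsW, hsO⟩ := hesc
  exact terminates_of_dominator_stageChains hP hD p hp k K O A hk hA hfr hAO hthr U W hUW hdomU
    ⟨m₁, s, hs, hsW, hsO⟩ hacc

/-- **TERMINATION FROM A NOETHERIAN RESIDUAL DOMINATOR (PROVED).**  `F = κ(W)`: if the residual dominator `Ū`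
itself is noetherian, the tower terminates. [this work] -/
theorem terminates_of_noetherianResidualDominator (hP : PersistenceRadical) (hD : StrictDrop) (p : ℕ)
    (hp : p.Prime) (k K : Type) [Field k] [CharP k p] [Field K] [Algebra k K] (O : ValuationSubring K)
    (A : Subalgebra k K) (hk : ∀ c : k, algebraMap k K c ∈ O) (hA : A.FG)
    (hfr : IsFractionRing ↥A K) (hAO : A.toSubring ≤ O.toSubring)
    (hthr : ¬ SingularPrimeThread O A)
    (W : ValuationSubring K) (m₁ : ℕ)
    (hesc : ∃ s ∈ tower O A m₁, s⁻¹ ∈ W ∧ s⁻¹ ∉ O)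
    (hW : ∀ m : ℕ, ∀ s ∈ tower O A m, s ∈ W)
    (Ū : ValuationSubring (ResidueField W))
    (hres : ∀ (m : ℕ) (s : K) (hs : s ∈ tower O A m), residue W ⟨s, hW m s hs⟩ ∈ Ū)
    (hdomr : ∀ (m : ℕ) (s : K) (hs : s ∈ tower O A m), s⁻¹ ∈ W →
      (residue W ⟨s, hW m s hs⟩)⁻¹ ∈ Ū → s⁻¹ ∈ O)
    (hN : IsNoetherianRing ↥Ū) :
    ∃ m : ℕ, IsRegularLocalRing ↥(tower O A m) :=
  terminates_of_traceChains hP hD p hp k K O A hk hA hfr hAO hthr W m₁ hesc hW Ū hres hdomr Set.univ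
    (fun m z hz => ⟨hW m z hz, Set.mem_univ _⟩)
    (fun r _ hr hch => chain_of_isNoetherianRing Ū hN r hr hch)

/-- **TERMINATION FROM A NOETHERIAN TRACE (PROVED).**  A threadless tower (radical persistence, StrictDrop)
CONFINED by `W` from stage `m₁` (stages `≥ m₁` inside `loc W (T_m₁)`, `T_m₁ ⊆ W`, escape witness `s ∈ T_m₁`,
`s⁻¹ ∈ W ∖ O`) terminates as soon as SOME valuation ring `Ū` of `κ(W)` containing the stage residues and
dominating the residual union has NOETHERIAN TRACE on the trace field `k(res_W T_m₁)`.  Any transcendence degree,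
any rank of `O`; no `hzd`. [this work] -/
theorem terminates_of_noetherianTrace (hP : PersistenceRadical) (hD : StrictDrop) (p : ℕ) (hp : p.Prime)
    (k K : Type) [Field k] [CharP k p] [Field K] [Algebra k K] (O : ValuationSubring K)
    (A : Subalgebra k K) (hk : ∀ c : k, algebraMap k K c ∈ O) (hA : A.FG)
    (hfr : IsFractionRing ↥A K) (hAO : A.toSubring ≤ O.toSubring)
    (hthr : ¬ SingularPrimeThread O A)
    (W : ValuationSubring K) [Algebra k W] [IsScalarTower k W K] (m₁ : ℕ)
    (hWT : ∀ s ∈ tower O A m₁, s ∈ W)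
    (hesc : ∃ s ∈ tower O A m₁, s⁻¹ ∈ W ∧ s⁻¹ ∉ O)
    (hconf : ∀ m : ℕ, m₁ ≤ m → tower O A m ≤ loc W (tower O A m₁))
    (hW : ∀ m : ℕ, ∀ s ∈ tower O A m, s ∈ W)
    (Ū : ValuationSubring (ResidueField W))
    (hres : ∀ (m : ℕ) (s : K) (hs : s ∈ tower O A m), residue W ⟨s, hW m s hs⟩ ∈ Ū)
    (hdomr : ∀ (m : ℕ) (s : K) (hs : s ∈ tower O A m), s⁻¹ ∈ W →
      (residue W ⟨s, hW m s hs⟩)⁻¹ ∈ Ū → s⁻¹ ∈ O)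
    (hN : IsNoetherianRing ↥(Ū.comap (algebraMap ((IntermediateField.adjoin k
      (Set.range fun x : ↥(tower O A m₁) => residue W ⟨(x : K), hWT x x.2⟩))) (ResidueField W)))) :
    ∃ m : ℕ, IsRegularLocalRing ↥(tower O A m) := by
  classical
  set F := (IntermediateField.adjoin k
      (Set.range fun x : ↥(tower O A m₁) => residue W ⟨(x : K), hWT x x.2⟩)) with hFdef
  -- every stage residue lies in the trace field
  have hzF : ∀ (m : ℕ) (z : K), z ∈ tower O A m →
      ∃ h : z ∈ W, residue W ⟨z, h⟩ ∈ (F : Set (ResidueField W)) := by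
    intro m z hz
    rcases le_total m m₁ with hle | hle
    · exact ⟨hWT z (d2rc_mem_tower_of_le O A hle hz),
        IntermediateField.subset_adjoin k _ ⟨⟨z, d2rc_mem_tower_of_le O A hle hz⟩, rfl⟩⟩
    · exact residue_mem_traceField_of_mem_loc W (tower O A m₁) hWT (hconf m hle hz)
  exact terminates_of_traceChains hP hD p hp k K O A hk hA hfr hAO hthr W m₁ hesc hW Ū hres hdomr
    (F : Set (ResidueField W)) hzF
    (fun r hrF hr hch => chain_of_noetherianTrace Ū F hN r (fun n => hrF n) hr hch)

/-- **THEOREM A (PROVED): CURVE-CONFINED THREADLESS TOWERS TERMINATE.**  A threadless tower (radical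
persistence, StrictDrop) confined by a valuation ring `W ∋ k` from stage `m₁` — `T_m₁ ⊆ W`, an escape witness
`s ∈ T_m₁` with `s⁻¹ ∈ W ∖ O` (the centre of `W` on `T_m₁` is not the closed point), all later stages inside
`loc W (T_m₁)` — whose TRACE FIELD `k(res_W T_m₁) ⊆ κ(W)` has transcendence degree `≤ 1` over `k` (the centre of
`W` on `T_m₁` is a CURVE or a point, e.g. `W` itself has residual transcendence degree `≤ 1`), has a regular
stage.  The trace field is finitely generated automatically (`traceField_top_fg`), so DEFECT `W` are allowed.  Every transcendence degree, every rank of `O`, `W` not comparable with `O`, no `hzd`.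
[this work; the mechanism of card 9 THM A with both paper steps removed] -/
theorem curveConfined_terminates (hP : PersistenceRadical) (hD : StrictDrop) (p : ℕ) (hp : p.Prime)
    (k K : Type) [Field k] [CharP k p] [Field K] [Algebra k K] (O : ValuationSubring K)
    (A : Subalgebra k K) (hk : ∀ c : k, algebraMap k K c ∈ O) (hA : A.FG)
    (hfr : IsFractionRing ↥A K) (hAO : A.toSubring ≤ O.toSubring)
    (hthr : ¬ SingularPrimeThread O A)
    (W : ValuationSubring K) [Algebra k W] [IsScalarTower k W K] (m₁ : ℕ)
    (hWT : ∀ s ∈ tower O A m₁, s ∈ W)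
    (hesc : ∃ s ∈ tower O A m₁, s⁻¹ ∈ W ∧ s⁻¹ ∉ O)
    (hconf : ∀ m : ℕ, m₁ ≤ m → tower O A m ≤ loc W (tower O A m₁))
    (hcurve : Algebra.trdeg k ↥((IntermediateField.adjoin k
      (Set.range fun x : ↥(tower O A m₁) => residue W ⟨(x : K), hWT x x.2⟩))) ≤ 1) :
    ∃ m : ℕ, IsRegularLocalRing ↥(tower O A m) := by
  classical
  set F := (IntermediateField.adjoin k
      (Set.range fun x : ↥(tower O A m₁) => residue W ⟨(x : K), hWT x x.2⟩)) with hFdef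
  -- the trace field is finitely generated: stages are essentially of finite type
  haveI : Algebra.EssFiniteType k ↥(tower O A m₁) := (tn_tower_invariant O A hk hA hfr hAO m₁).2.2
  have hFfg : (⊤ : IntermediateField k ↥F).FG := traceField_top_fg W (tower O A m₁) hWT
  -- all stages lie in `W`
  have hW : ∀ m : ℕ, ∀ s ∈ tower O A m, s ∈ W := by
    intro m s hs
    rcases le_total m m₁ with hle | hle
    · exact hWT s (d2rc_mem_tower_of_le O A hle hs)
    · exact loc_le W (tower O A m₁) hWT s (hconf m hle hs)
  -- Chevalley in `κ(W)`
  obtain ⟨Ū, hres, hdomr⟩ := exists_traceDominator O A hk hAO W hW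
  -- the trace of `Ū` on `F` is a DVR: `k ⊆ Ū`, and the escape witness's residue is in `F ∩ Ū` with inverse off `Ū`
  obtain ⟨s, hs, hsW, hsO⟩ := hesc
  have hkU : ∀ c : k, algebraMap k (ResidueField W) c ∈ Ū := fun c => by
    have hcT : algebraMap k K c ∈ tower O A m₁ := (tower O A m₁).algebraMap_mem c
    have e : algebraMap k (ResidueField W) c = residue W ⟨algebraMap k K c, hW m₁ _ hcT⟩ := by
      have e1 : (⟨algebraMap k K c, hW m₁ _ hcT⟩ : W) = algebraMap k W c :=
        Subtype.ext (IsScalarTower.algebraMap_apply k W K c)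
      rw [e1, IsScalarTower.algebraMap_apply k W (ResidueField W) c, ResidueField.algebraMap_eq]
    rw [e]; exact hres m₁ _ hcT
  have hxF : residue W ⟨s, hW m₁ s hs⟩ ∈ F :=
    IntermediateField.subset_adjoin k _ ⟨⟨s, hs⟩, rfl⟩
  have hxi : (residue W ⟨s, hW m₁ s hs⟩)⁻¹ ∉ Ū := fun h => hsO (hdomr m₁ s hs hsW h)
  have hN : IsNoetherianRing ↥(Ū.comap (algebraMap F (ResidueField W))) :=
    isNoetherianRing_trace_of_curve Ū F hkU hxF hxi hFfg hcurve
  exact terminates_of_noetherianTrace hP hD p hp k K O A hk hA hfr hAO hthr W m₁ hWT ⟨s, hs, hsW, hsO⟩ hconf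
    hW Ū hres hdomr hN

/-- **THEOREM A packaged over a `k ⊆ W` hypothesis** (the `k`-algebra structure on `W` manufactured by
`algebraOfMem`). [this work] -/
theorem curveConfined_terminates' (hP : PersistenceRadical) (hD : StrictDrop) (p : ℕ) (hp : p.Prime)
    (k K : Type) [Field k] [CharP k p] [Field K] [Algebra k K] (O : ValuationSubring K)
    (A : Subalgebra k K) (hk : ∀ c : k, algebraMap k K c ∈ O) (hA : A.FG)
    (hfr : IsFractionRing ↥A K) (hAO : A.toSubring ≤ O.toSubring)
    (hthr : ¬ SingularPrimeThread O A)
    (W : ValuationSubring K) (hkW : ∀ c : k, algebraMap k K c ∈ W) (m₁ : ℕ)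
    (hWT : ∀ s ∈ tower O A m₁, s ∈ W)
    (hesc : ∃ s ∈ tower O A m₁, s⁻¹ ∈ W ∧ s⁻¹ ∉ O)
    (hconf : ∀ m : ℕ, m₁ ≤ m → tower O A m ≤ loc W (tower O A m₁))
    (hcurve : letI : Algebra k W := algebraOfMem k W hkW;
      Algebra.trdeg k ↥((IntermediateField.adjoin k
      (Set.range fun x : ↥(tower O A m₁) => residue W ⟨(x : K), hWT x x.2⟩))) ≤ 1) :
    ∃ m : ℕ, IsRegularLocalRing ↥(tower O A m) := by
  letI : Algebra k W := algebraOfMem k W hkW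
  haveI : IsScalarTower k W K := isScalarTower_algebraOfMem k W hkW
  exact curveConfined_terminates hP hD p hp k K O A hk hA hfr hAO hthr W m₁ hWT hesc hconf hcurve

/-- **COROLLARY A₁ (PROVED): confinement by a valuation ring of residual transcendence degree `≤ 1`.**
[this work] -/
theorem curveResidueField_terminates (hP : PersistenceRadical) (hD : StrictDrop) (p : ℕ) (hp : p.Prime)
    (k K : Type) [Field k] [CharP k p] [Field K] [Algebra k K] (O : ValuationSubring K)
    (A : Subalgebra k K) (hk : ∀ c : k, algebraMap k K c ∈ O) (hA : A.FG)
    (hfr : IsFractionRing ↥A K) (hAO : A.toSubring ≤ O.toSubring)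
    (hthr : ¬ SingularPrimeThread O A)
    (W : ValuationSubring K) [Algebra k W] [IsScalarTower k W K] (m₁ : ℕ)
    (hWT : ∀ s ∈ tower O A m₁, s ∈ W)
    (hesc : ∃ s ∈ tower O A m₁, s⁻¹ ∈ W ∧ s⁻¹ ∉ O)
    (hconf : ∀ m : ℕ, m₁ ≤ m → tower O A m ≤ loc W (tower O A m₁))
    (hW1 : Algebra.trdeg k (ResidueField W) ≤ 1) :
    ∃ m : ℕ, IsRegularLocalRing ↥(tower O A m) :=
  curveConfined_terminates hP hD p hp k K O A hk hA hfr hAO hthr W m₁ hWT hesc hconf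
    ((trdeg_traceField_le W _ hWT).trans hW1)

/-- **COROLLARY A₂ (PROVED): COMPOSITE OVER A CURVE.**  A threadless tower (radical persistence, StrictDrop) along
a valuation ring `O` having a COARSENING `W ≥ O` of residual transcendence degree `≤ 1` over `k` into which the
tower escapes (`s⁻¹ ∈ W ∖ O` for some stage element `s`; automatic under β1's maximality binder when `O < W`)
terminates — for EVERY rank and rational rank of `W` and WITHOUT `κ(W)` being finitely generated (no discreteness,
no `hacc`: contrast the tree's `Coarsening.kernelThreadless_of_discreteCoarsening`).  Confinement comes from CT +
persistence + the tree's `Coarsening.tower_le_loc_of_unit`. [this work] -/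
theorem curveCoarsening_terminates (hP : PersistenceRadical) (hD : StrictDrop) (p : ℕ) (hp : p.Prime)
    (k K : Type) [Field k] [CharP k p] [Field K] [Algebra k K] (O : ValuationSubring K)
    (A : Subalgebra k K) (hk : ∀ c : k, algebraMap k K c ∈ O) (hA : A.FG)
    (hfr : IsFractionRing ↥A K) (hAO : A.toSubring ≤ O.toSubring)
    (hthr : ¬ SingularPrimeThread O A)
    (W : ValuationSubring K) [Algebra k W] [IsScalarTower k W K] (hOW : O ≤ W)
    (hesc : ∃ m : ℕ, ∃ s ∈ tower O A m, s⁻¹ ∈ W ∧ s⁻¹ ∉ O)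
    (hW1 : Algebra.trdeg k (ResidueField W) ≤ 1) :
    ∃ m : ℕ, IsRegularLocalRing ↥(tower O A m) := by
  classical
  by_cases h0 : IsRegularLocalRing ↥(tower O A 0)
  · exact ⟨0, h0⟩
  have hPR : ∀ m : ℕ, ∀ x ∈ ca (tower O A m), ∃ N : ℕ, 1 ≤ N ∧ x ^ N ∈ ca (tower O A (m + 1)) :=
    hP p hp k K O A hk hA hfr hAO
  have hdrop : ∀ m : ℕ, ¬ IsRegularLocalRing ↥(tower O A m) → ∃ m' : ℕ, m < m' ∧
      ∃ y ∈ ca (tower O A m'), y ≠ 0 ∧ ∀ x ∈ ca (tower O A m), x ≠ 0 → y * x⁻¹ ∉ O :=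
    hD p hp k K O A hk hA hfr hAO
  have hne : ∃ m, ∃ x ∈ ca (tower O A m), x ≠ 0 := by
    obtain ⟨m', -, y, hy, hy0, -⟩ := hdrop 0 h0
    exact ⟨m', y, hy, hy0⟩
  -- CT: a non-zero `W`-unit in some `ca(T_M)`; persistence pushes it to stage `M + 1 ≥ 1`
  obtain ⟨M, c, hc, hc0, hcW⟩ := Coarsening.unitCreating_of_noThread O A hk hA hfr hAO hPR hne hthr W hesc
  obtain ⟨N, hN1, hcN⟩ := hPR M c hc
  have hunit : ∃ c ∈ ca (tower O A (M + 1)), c ≠ 0 ∧ c⁻¹ ∈ W :=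
    ⟨c ^ N, hcN, pow_ne_zero N hc0, by rw [← inv_pow]; exact W.pow_mem hcW N⟩
  -- confinement from stage `m₁ := M + 1 + m`, which also holds the escape witness
  obtain ⟨m, s, hs, hsW, hsO⟩ := hesc
  have hWT : ∀ s ∈ tower O A (M + 1 + m), s ∈ W := fun s hs => hOW (stage_le O A hk hAO _ s hs)
  have hconf : ∀ m' : ℕ, M + 1 + m ≤ m' → tower O A m' ≤ loc W (tower O A (M + 1 + m)) := by
    intro m' hm'
    have h1 : tower O A m' ≤ loc W (tower O A (M + 1)) :=
      Coarsening.tower_le_loc_of_unit O A hk hA hfr hAO hPR W hOW hunit (by omega)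
    refine h1.trans ?_
    rw [loc_eq_locAt, loc_eq_locAt]
    exact SyzygyFlattening.locAt_mono W fun _ hx => d2rc_mem_tower_of_le O A (Nat.le_add_right (M + 1) m) hx
  exact curveResidueField_terminates hP hD p hp k K O A hk hA hfr hAO hthr W (M + 1 + m) hWT
    ⟨s, d2rc_mem_tower_of_le O A (Nat.le_add_left m (M + 1)) hs, hsW, hsO⟩ hconf hW1


end Summit.ResolutionOfSingularities.ResolutionOfSingularities.Theorems.NoZeno.TraceSocle

end
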